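import Mathlib
import HarnessLib
import Summits.Parity.GeneralizedHardyLittlewood.Theses.LeeYangFibres
import Literature.NumberTheory.Sieve.BombieriAsymptoticSieve

/-!
# Sketch — crux ideas for `CellParityLaw` (stmt-Parity-14109), ideator k = 2, round 1

First-lemma signatures for the two idea cards

* `Ideas/signed-switching-moebius-residual.md` — decls `upperTruncSwitch`,
  `roughCell`, `cellSetTwo`, `midResidualTwo`, `DilatedMoebiusCellsMid`, `BVRoughCells`,
  `CellParityLawAt`, `cellParityLaw_iff_forall_at`, `ReductionTwo`, `fullSwitchAtom`,
  `DilatedMoebiusConfigs`, `ReductionAll`, `cornerUpperBound_of_law` (the 2^t corollary).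
* `Ideas/buchstab-scale-flow.md` — decls `cellAtLevel`, `derivedSystem`, `jointBuchstabStep`.

Everything is a `def … : Prop` (statements only; nothing is claimed proved here) except the two
trivial `theorem`s marked, which are proved.
-/

namespace Summit.Parity.GeneralizedHardyLittlewood.Cruxes.CellParityLaw.Sketch

open scoped BigOperators
open Finset Literature.NumberTheory.Sieve
open Classical

noncomputable section

/-! ## Card 1 — signed switching: the exact divisor switch -/

/-- FIRST LEMMA (card 1). The exact divisor switch for the upper truncation
`∑_{d ∣ m, d ≥ y} μ(d) (log (m/d))^k` of `Λ_k(m)` (tree: `BombieriSieve.truncLambdaUpper`), summed over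
an arbitrary finite set `S` of values (think `S = {ψ_i(n) : n ∈ 𝒞 ∩ K}`): reindex by the SMALL
complementary divisor `e = m/d ≤ m/y`. Over `S ∌ 0` both sides are the same finite double sum; the
content is bookkeeping (`Nat.divisorsAntidiagonal` ↔ `(e, m/e)`), no analysis. -/
def upperTruncSwitch : Prop :=
  ∀ (S : Finset ℕ), 0 ∉ S → ∀ (k : ℕ) (y : ℝ), 0 < y →
    ∑ m ∈ S, BombieriSieve.truncLambdaUpper k y m =
      ∑ e ∈ S.biUnion Nat.divisors,
        Real.log e ^ k *
          ∑ m ∈ S.filter (fun m => e ∣ m ∧ y ≤ ((m / e : ℕ) : ℝ)),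
            (ArithmeticFunction.moebius (m / e) : ℝ)

/-- The rough `Ω`-cell predicate of the crux (inlined there with `Nat.minFac`, `cardFactors`):
`P⁻(m) > N^{1/u}` and `Ω(m) = j`. -/
def roughCell (N u j m : ℕ) : Prop :=
  (N : ℝ) ^ ((1 : ℝ) / u) < (Nat.minFac m : ℝ) ∧ ArithmeticFunction.cardFactors m = j

/-- `t = 2`: the conditioning set `𝒞 = {n ∈ K ∩ [-N,N] : ψ_{1-i}(n) ∈ cell j}` (the OTHER form sits
in the rough cell `j`; form `i` is the one being sieved). -/
def cellSetTwo (Ψ : Fin 2 → AffLinForm 1) (K : Set (Fin 1 → ℝ)) (N u : ℕ) (i : Fin 2) (j : ℕ) :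
    Finset (Fin 1 → ℤ) :=
  (latticeBox 1 N).filter fun n => realPoint n ∈ K ∧ roughCell N u j ((Ψ i.rev).eval n).toNat

/-- `t = 2`: the MID-RANGE dilated Möbius residual of coordinate `i` against the cell `j` of the other
form — the `Σ₂`-piece of the Friedlander–Iwaniec dissection of `∑_{n ∈ 𝒞} Λ_k(ψ_i(n))` truncated at
the Bombieri–Vinogradov level `y = N^{1/2-δ}` and switched to the small codivisor `e`:
`∑_{E₀ ≤ e ≤ N^{1/2+δ}} (log e)^k · |∑_{n ∈ 𝒞 : e ∣ ψ_i(n), ψ_i(n)/e > N^{1/2-δ}} μ(ψ_i(n)/e)|`,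
`E₀ = exp((log N)^{(k-2)/(k+1)})` (below `E₀` the weight `(log e)^k ≤ (log N)^{k(k-2)/(k+1)}` makes
the range negligible trivially: this is where `k ≥ 3` is used and why NO lopsided atom is needed). -/
def midResidualTwo (Ψ : Fin 2 → AffLinForm 1) (K : Set (Fin 1 → ℝ)) (N u k : ℕ) (i : Fin 2)
    (j : ℕ) (δ : ℝ) : ℝ :=
  ∑ e ∈ Icc ⌈Real.exp (Real.log N ^ (((k : ℝ) - 2) / (k + 1)))⌉₊ ⌊(N : ℝ) ^ ((1 : ℝ) / 2 + δ)⌋₊,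
    Real.log e ^ k *
      |∑ n ∈ (cellSetTwo Ψ K N u i j).filter (fun n =>
          (e : ℤ) ∣ (Ψ i).eval n ∧
            (N : ℝ) ^ ((1 : ℝ) / 2 - δ) < ((((Ψ i).eval n).toNat / e : ℕ) : ℝ)),
        (ArithmeticFunction.moebius (((Ψ i).eval n).toNat / e) : ℝ)|

/-- ATOM (card 1, `t = 2`): **mid-range dilated Möbius–cell orthogonality with a log² saving.**
For the prime cell `j = 1` of the other form this is Harman's missing Type-II input
`∑_{d∼D} |∑_{dn = p+2} μ(n)|` [Harman2007 §14.2, PDF p.286], but only for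
`D ∈ [exp((log N)^{(k-2)/(k+1)}), N^{1/2+δ}]` and with the explicit saving `(log N)^{-2-}`
relative to the trivial bound; for composite cells `j ≥ 2` the conditioning side is a convolution
of `j` prime indicators (bilinear). Uniform over systems of size `≤ L` as in the crux. -/
def DilatedMoebiusCellsMid : Prop :=
  ∀ (L u k : ℕ), 2 ≤ u → 3 ≤ k → ∀ δ : ℝ, 0 < δ → δ < 1 / 4 → ∀ ε : ℝ, 0 < ε →
    ∃ N₀ : ℕ, ∀ N : ℕ, N₀ ≤ N →
      ∀ Ψ : Fin 2 → AffLinForm 1, IsNondegenerateSystem Ψ → affLinSize Ψ N ≤ L →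
        ∀ K : Set (Fin 1 → ℝ), Convex ℝ K → K ⊆ realBox 1 N →
          ∀ i : Fin 2, ∀ j : ℕ, 1 ≤ j → j ≤ u →
            midResidualTwo Ψ K N u k i j δ ≤ ε * N * Real.log N ^ (k - 2)

/-- SUPPORT (card 1): **Bombieri–Vinogradov for rough `Ω`-cells of ONE affine form** (values
`ψ(n) = a n + b`, `|a| ≤ L`, `|b| ≤ LN`, `n` in an interval), level `N^{1/2-δ}`, one arbitrary
reduced residue `c q` and one height `x q` per modulus — the Type-I input of the FI dissection at
`y = N^{1/2-δ}`. Provable now (cells of one form = convolutions of `j` prime indicators supported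
above `N^{1/u}`; Siegel–Walfisz + the bilinear large sieve, tree:
`Literature.NumberTheory.Sieve.BombieriFriedlanderIwaniecTheorem0b_holds`; `j = 1` is BV). -/
def BVRoughCells : Prop :=
  ∀ (L u : ℕ), 2 ≤ u → ∀ δ : ℝ, 0 < δ → ∀ A : ℝ, 0 < A →
    ∃ N₀ : ℕ, ∀ N : ℕ, N₀ ≤ N →
      ∀ ψ : AffLinForm 1, ψ.coeff ≠ 0 → affLinSize ![ψ] N ≤ L → ∀ j : ℕ, 1 ≤ j → j ≤ u →
        ∀ (c : ℕ → ℤ) (x : ℕ → ℤ), (∀ q, -(N : ℤ) ≤ x q ∧ x q ≤ N) →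
          ∑ q ∈ Icc 1 ⌊(N : ℝ) ^ ((1 : ℝ) / 2 - δ)⌋₊,
            (if IsCoprime (c q) (q : ℤ) then
              |((((Icc (-(N : ℤ)) (x q)).filter (fun n =>
                    roughCell N u j (ψ.eval ![n]).toNat ∧ (q : ℤ) ∣ ψ.eval ![n] - c q)).card : ℕ) : ℝ)
                - ((((Icc (-(N : ℤ)) (x q)).filter (fun n =>
                    roughCell N u j (ψ.eval ![n]).toNat ∧ IsCoprime (ψ.eval ![n]) (q : ℤ))).card : ℕ) : ℝ)
                  / Nat.totient q|
             else 0)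
            ≤ N / Real.log N ^ A

/-- The crux at a FIXED number of forms `t` (verbatim body of
`LeeYangFibres.CellParityLaw` with the leading `∀ t` removed). -/
def CellParityLawAt (t : ℕ) : Prop :=
  ∀ (L u : ℕ), 1 ≤ t → 2 ≤ u → ∀ ε : ℝ, 0 < ε → ∃ N₀ : ℕ, ∀ N : ℕ, N₀ ≤ N → ∀ Ψ : Fin t → Literature.NumberTheory.Sieve.AffLinForm 1, Literature.NumberTheory.Sieve.IsNondegenerateSystem Ψ → Literature.NumberTheory.Sieve.affLinSize Ψ N ≤ L → ∀ K : Set (Fin 1 → ℝ), Convex ℝ K → K ⊆ Literature.NumberTheory.Sieve.realBox 1 N → ∃ θ : Finset (Fin t) → ℝ, θ ∅ = 1 ∧ (∀ S, |θ S| ≤ 2) ∧ ∀ j : Fin t → ℕ, (∀ i, 1 ≤ j i ∧ j i ≤ u) → |((((Literature.NumberTheory.Sieve.latticeBox 1 N).filter (fun n => Literature.NumberTheory.Sieve.realPoint n ∈ K ∧ ∀ i, (N : ℝ) ^ ((1 : ℝ) / u) < (Nat.minFac ((Ψ i).eval n).toNat : ℝ) ∧ ArithmeticFunction.cardFactors ((Ψ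 i).eval n).toNat = j i)).card : ℕ) : ℝ) - (∑ S : Finset (Fin t), θ S * ∏ i ∈ S, (-1 : ℝ) ^ (j i + 1)) * (Literature.NumberTheory.Sieve.archFactor Ψ K * Literature.NumberTheory.Sieve.singularProduct Ψ * ∏ i, ((((Finset.Icc 1 N).filter (fun m => (N : ℝ) ^ ((1 : ℝ) / u) < (Nat.minFac m : ℝ) ∧ ArithmeticFunction.cardFactors m = j i)).card : ℕ) : ℝ) / N)| ≤ ε * N / Real.log N ^ t

/-- The crux is the conjunction of its fixed-`t` cases (pure logic; proved). -/
theorem cellParityLaw_iff_forall_at :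
    Summit.Parity.GeneralizedHardyLittlewood.Theses.LeeYangFibres.CellParityLaw ↔
      ∀ t : ℕ, CellParityLawAt t := by
  constructor
  · intro h t L u ht hu ε hε
    exact h t L u ht hu ε hε
  · intro h t L u ht hu ε hε
    exact h t L u ht hu ε hε

/-- REDUCTION (card 1, `t = 2`): the signed Friedlander–Iwaniec dissection at level `N^{1/2-δ}`
(`Σ₁` by `BVRoughCells` + FI Lemma 12-type main term, `Σ₀` by an upper-bound sieve, `Σ₂` =
`midResidualTwo`), Bombieri's completeness (parity-even type weights are spanned by the
`Λ_{k⃗}`, `max k_ν ≥ 2`, `|k⃗| ≥ 3`), the comparison with `a_n ≡ 1`, and Alladi's anatomy of the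
model cells give the `t = 2` law. The XL but standard stub of the line. -/
def ReductionTwo : Prop :=
  BVRoughCells → DilatedMoebiusCellsMid → CellParityLawAt 2

/-- General `t`: the FULLY-SWITCHED residual atom of the `(t-1)`-dimensional signed sieve conditioned
on ONE rough cell `jc` of ONE form `c`: an `|S| = t-1`-point Möbius correlation along the forms
`ψ_s / e_s`, `s ≠ c`, with small codivisors `e_s ∈ [E₀, N^{1/2+δ}]`, weighted `∏ (log e_s)^k`,
tested against the single-form cell. (`t = 2`: `midResidualTwo`.) The mixed pieces — some
coordinates unswitched, carrying `d_s ∣ ψ_s(n)`, `d_s ≤ N^{1/2-δ}` with smooth weights — have the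
same shape with fewer Möbius factors and are omitted from this sketch. -/
def fullSwitchAtom (t : ℕ) (Ψ : Fin t → AffLinForm 1) (K : Set (Fin 1 → ℝ)) (N u k : ℕ)
    (c : Fin t) (jc : ℕ) (δ : ℝ) : ℝ :=
  ∑ e ∈ Fintype.piFinset (fun _ : Fin t =>
      Icc ⌈Real.exp (Real.log N ^ (((k : ℝ) - 2) / (k + 1)))⌉₊ ⌊(N : ℝ) ^ ((1 : ℝ) / 2 + δ)⌋₊),
    (∏ s ∈ univ.erase c, Real.log (e s) ^ k) *
      |∑ n ∈ (latticeBox 1 N).filter (fun n =>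
          realPoint n ∈ K ∧ roughCell N u jc ((Ψ c).eval n).toNat ∧
            ∀ s, s ≠ c → ((e s : ℤ) ∣ (Ψ s).eval n ∧
              (N : ℝ) ^ ((1 : ℝ) / 2 - δ) < ((((Ψ s).eval n).toNat / e s : ℕ) : ℝ))),
        ∏ s ∈ univ.erase c, (ArithmeticFunction.moebius (((Ψ s).eval n).toNat / e s) : ℝ)|

/-- ATOM (card 1, all `t`): every fully-switched residual is `o` of the main-term scale
`(N / log N) · (log N)^{(k-1)(t-1)}` (a `(log N)^{2(t-1)+}` saving over trivial). -/
def DilatedMoebiusConfigs : Prop :=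
  ∀ (t L u k : ℕ), 2 ≤ t → 2 ≤ u → 3 ≤ k → ∀ δ : ℝ, 0 < δ → δ < 1 / 4 → ∀ ε : ℝ, 0 < ε →
    ∃ N₀ : ℕ, ∀ N : ℕ, N₀ ≤ N →
      ∀ Ψ : Fin t → AffLinForm 1, IsNondegenerateSystem Ψ → affLinSize Ψ N ≤ L →
        ∀ K : Set (Fin 1 → ℝ), Convex ℝ K → K ⊆ realBox 1 N →
          ∀ c : Fin t, ∀ jc : ℕ, 1 ≤ jc → jc ≤ u →
            fullSwitchAtom t Ψ K N u k c jc δ ≤ ε * N * Real.log N ^ ((k - 1) * (t - 1) - 1)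

/-- REDUCTION (card 1, all `t`; mixed pieces suppressed in this sketch, see `fullSwitchAtom`):
single-cell conditioning + `(t-1)`-dimensional signed sieve + composite-slice connectivity. -/
def ReductionAll : Prop :=
  BVRoughCells → DilatedMoebiusConfigs →
    Summit.Parity.GeneralizedHardyLittlewood.Theses.LeeYangFibres.CellParityLaw

/-- HARDNESS CERTIFICATE (card 1, recorded): the crux implies the PARITY upper bound `2^t` for the
all-prime rough cell — `C_{(1,…,1)} ≤ (2^t + η)·archFactor·singularProduct·(A₁(N)/N)^t` for large
`N` (`u ≥ 4`: every sign pattern is realised by a non-negligible cell, so the fitted Walsh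
polynomial is `≥ -o(1)` pointwise with mean `θ_∅ = 1`, hence `≤ 2^t + o(1)`). Known for `t = 2`
(`4`, BV + Selberg); OPEN for `t ≥ 3` (BV + the `(t-1)`-dimensional Selberg sieve gives
`4^{t-1}(t-1)!`, e.g. `32` for triples against `8`). Pure bookkeeping from the crux; stated, not
proved, here. -/
def cornerUpperBound_of_law : Prop :=
  Summit.Parity.GeneralizedHardyLittlewood.Theses.LeeYangFibres.CellParityLaw →
    ∀ (t L : ℕ), 1 ≤ t → ∀ η : ℝ, 0 < η → ∃ u : ℕ, 4 ≤ u ∧ ∃ N₀ : ℕ, ∀ N : ℕ, N₀ ≤ N →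
      ∀ Ψ : Fin t → AffLinForm 1, IsNondegenerateSystem Ψ → affLinSize Ψ N ≤ L →
        ∀ K : Set (Fin 1 → ℝ), Convex ℝ K → K ⊆ realBox 1 N →
          ((((latticeBox 1 N).filter (fun n => realPoint n ∈ K ∧
              ∀ i, roughCell N u 1 ((Ψ i).eval n).toNat)).card : ℕ) : ℝ)
            ≤ ((2 : ℝ) ^ t + η) * (archFactor Ψ K * singularProduct Ψ *
                (((((Icc 1 N).filter (fun m => roughCell N u 1 m)).card : ℕ) : ℝ) / N) ^ t)
              + η * N / Real.log N ^ t

/-! ## Card 2 — Buchstab scale flow: the exact joint Buchstab step -/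

/-- Joint cells at a general real roughness LEVEL `y` with a per-coordinate strictness flag
(`strict s = true`: `P⁻ > y`; `false`: `P⁻ ≥ y`) — needed to state the tie-broken Buchstab step.
Conventions forced by Mathlib (`Nat.minFac 1 = 1`, `Nat.minFac 0 = 2`, `cardFactors 0 = 0`): the value
`1` (empty product, `Ω = 0`) counts as rough at every level, the value `0` (`toNat` of a non-positive value)
never does; with all `j s ≥ 1` this changes nothing, it matters for the peeled coordinate (`j i - 1 = 0`).
Brute-force verified for `t ∈ {2,3}`, `N ≤ 400`, `p ≤ 13` (check_buchstab_step.py, 1500 random instances). -/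
def cellAtLevel (t : ℕ) (Ψ : Fin t → AffLinForm 1) (K : Set (Fin 1 → ℝ)) (N : ℕ) (y : ℝ)
    (strict : Fin t → Bool) (j : Fin t → ℕ) : ℕ :=
  ((latticeBox 1 N).filter fun n => realPoint n ∈ K ∧ ∀ s,
      ((Ψ s).eval n).toNat ≠ 0 ∧
      (((Ψ s).eval n).toNat = 1 ∨
        (if strict s then y < (Nat.minFac ((Ψ s).eval n).toNat : ℝ)
          else y ≤ (Nat.minFac ((Ψ s).eval n).toNat : ℝ))) ∧
      ArithmeticFunction.cardFactors ((Ψ s).eval n).toNat = j s).card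

/-- The DERIVED system `Ψ^{(i,p,r)}`: restrict to `n = r + p n'` (a class with `p ∣ ψ_i(r + p·0)`,
i.e. `p ∣ ψ_i(r)`) and divide form `i` by `p`; the other forms keep their values
(`ψ_s(r + p n') = (p a_s) n' + (a_s r + b_s)`). -/
def derivedSystem (t : ℕ) (Ψ : Fin t → AffLinForm 1) (i : Fin t) (p : ℕ) (r : ℤ) :
    Fin t → AffLinForm 1 := fun s =>
  if s = i then
    ⟨fun _ => (Ψ i).coeff 0, ((Ψ i).coeff 0 * r + (Ψ i).const) / p⟩
  else
    ⟨fun _ => (p : ℤ) * (Ψ s).coeff 0, (Ψ s).coeff 0 * r + (Ψ s).const⟩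

/-- FIRST LEMMA (card 2): **the exact joint Buchstab step at one prime `p`.** Lowering the common
roughness level through the prime `p` adds exactly the configurations whose FIRST (in the
tie-break order) form with smallest prime factor `p` is `i`; these are cells `j - e_i` of the derived
systems `Ψ^{(i,p,r)}` over the residues `r mod p` with `p ∣ ψ_i(r)`, at level `p` with strictness
`(s < i ↦ strict, s = i ↦ P⁻(ψ_i/p) ≥ p, s > i ↦ non-strict)`, on the rescaled body
`K' = (K - r)/p`. A finite combinatorial identity (unique factorisation + CRT bookkeeping); the
flow card integrates it over `p ∈ (N^{1/u}, N^{1/2}]`. (Side conditions: `K ⊆ [-N,N]`, `p` prime, all `j s ≥ 1`; the body rescaling is written with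
`Set.image`.) -/
def jointBuchstabStep : Prop :=
  ∀ (t : ℕ) (Ψ : Fin t → AffLinForm 1) (K : Set (Fin 1 → ℝ)) (N : ℕ), K ⊆ realBox 1 N →
    ∀ p : ℕ, p.Prime → ∀ j : Fin t → ℕ, (∀ s, 1 ≤ j s) →
      (cellAtLevel t Ψ K N p (fun _ => false) j : ℤ) - cellAtLevel t Ψ K N p (fun _ => true) j =
        ∑ i : Fin t, ∑ r ∈ (Finset.range p).filter (fun r => (p : ℤ) ∣ (Ψ i).eval ![(r : ℤ)]),
          (cellAtLevel t (derivedSystem t Ψ i p r)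
              ((fun x : Fin 1 → ℝ => fun _ => (x 0 - r) / p) '' K) N p
              (fun s => decide (s < i)) (Function.update j i (j i - 1)) : ℤ)

end

end Summit.Parity.GeneralizedHardyLittlewood.Cruxes.CellParityLaw.Sketch
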